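import Literature.RepresentationTheory.TwistedCoinvariantsCompactEigenvector
import Literature.RepresentationTheory.CharacterIsotypicSubspace
import Literature.NumberTheory.Automorphic.Liu2021.Def411AsPrinted
import HarnessLib

/-!
# Compact groups: the `χ`-isotypic subspace maps isomorphically onto the `χ`-coinvariants
# ([BernsteinZelevinsky1976, §2.1–2.3]; [MoeglinVignerasWaldspurger1987, Chap. 2 II.2])

Topic `RepresentationTheory`; namespace `Literature.RepresentationTheory.TwistedCoinv` (continuing
`TwistedCoinvariants`, `TwistedCoinvariantsCompactEigenvector`).  KERNEL ONLY: theorems, 0 definitions, 0 named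
facts, 0 sorry.  The «compact-centre dictionary» (node E0 of the compact-member Howe duality, [Howe1979] §11):

for a representation `ρ : Representation k H S` (`k` a field of characteristic `0`), a character `χ : H →* kˣ`, the
`χ`-ISOTYPIC SUBSPACE (tree `weightSpace ρ id χ = {v | ∀ h, ρ h v = χ h • v}`, `CharacterIsotypicSubspace.lean`)
and the `χ`-COINVARIANTS `Coinv ρ χ = S ⧸ span {ρ h w - χ h • w}` with quotient map `mk ρ χ`:

* §1 (algebra; hypothesis: every vector is fixed by a normal finite-index subgroup inside `ker χ`)
  `exists_mem_weightSpace_mk_eq_of_forall_exists_normal` — every class is the class of an eigenvector (the averaging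
  projector `[H:N]⁻¹ Σ_{q ∈ H/N} χ(q̃)⁻¹ ρ(q̃)`), `eq_of_mk_eq_of_forall_exists_normal` — `mk` is injective on the
  isotypic subspace (tree `mk_ne_zero_of_eigenvector_of_forall_exists_normal`);
* §2 (topology: `H` COMPACT, `ρ` SMOOTH, `ker χ` OPEN) `exists_mem_weightSpace_mk_eq`, `eq_of_mk_eq`,
  **`bijective_mk_domRestrict_weightSpace`** — `mk` restricts to a linear BIJECTION
  `weightSpace ρ id χ → Coinv ρ χ`; `exists_linearEquiv_weightSpace_coinv` (the equivalence, with `e v = mk v`);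
  `map_weightSpace_le` — the isotypic subspace is stable under every operator commuting with `ρ(H)` (so under a
  commuting representation `ρV` of another group `G`, on which `mk` intertwines `ρV` with `rep χ ρV hc` by `rep_mk`);
* §3 **`isIrreducibleOrZero_rep_iff`** — for commuting `ρV : Representation ℂ G S`:
  `Liu2021.IsIrreducibleOrZero (rep χ ρV hc) ↔` every `ρV`-stable subspace of the isotypic subspace is `⊥` or all
  of it (the lattice of subrepresentations of the coinvariants is that of the `ρV`-stable subspaces of
  `weightSpace ρ id χ`).

## References
* [BernsteinZelevinsky1976] I. N. Bernstein, A. V. Zelevinsky, Russian Math. Surveys 31 (1976), §2.1–2.3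
  (coinvariants of smooth representations of compact totally disconnected groups; exactness of `V ↦ V_{H,χ}`).
* [MoeglinVignerasWaldspurger1987] C. Mœglin, M.-F. Vignéras, J.-L. Waldspurger, LNM 1291 (1987), Chap. 2 II.2,
  Chap. 3 IV.
* [Howe1979] R. Howe, *θ-series and invariant theory*, Proc. Symp. Pure Math. 33.1 (1979), §11.
-/

set_option autoImplicit false

noncomputable section

open scoped BigOperators

namespace Literature.RepresentationTheory.TwistedCoinv

/-! ## §1. Algebra: averaging over a finite quotient -/

section Algebra

variable {k : Type*} [Field k] {H : Type*} [Group H] {S : Type*} [AddCommGroup S] [Module k S]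
  (ρ : Representation k H S) (χ : H →* kˣ)

/-- The isotypic subspace is stable under every linear operator commuting with `ρ(H)`. [cite: BernsteinZelevinsky1976, §2.1] -/
theorem map_weightSpace_le (T : S →ₗ[k] S) (hT : ∀ h : H, Commute T (ρ h)) :
    (weightSpace ρ id (fun h => ((χ h : kˣ) : k))).map T ≤ weightSpace ρ id (fun h => ((χ h : kˣ) : k)) := by
  rintro _ ⟨v, hv, rfl⟩
  rw [SetLike.mem_coe, mem_weightSpace] at hv
  rw [mem_weightSpace]
  intro h
  have e := LinearMap.congr_fun (hT h).eq v
  simp only [Module.End.mul_apply] at e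
  have hvh : ρ h v = ((χ h : kˣ) : k) • v := hv h
  change ρ h (T v) = _
  rw [← e, hvh, map_smul]

/-- On the isotypic subspace the averaging sum `Σ_{q ∈ H/N} χ(q̃)⁻¹ • ρ(q̃) v` is `[H : N] • v`.
(Private step.) [folklore] -/
private theorem sum_apply_of_mem_weightSpace (N : Subgroup H) [Fintype (H ⧸ N)] {v : S}
    (hv : ∀ h : H, ρ h v = ((χ h : kˣ) : k) • v) :
    ∑ q : H ⧸ N, (((χ q.out)⁻¹ : kˣ) : k) • ρ q.out v = (Fintype.card (H ⧸ N) : k) • v := by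
  have hterm : ∀ q : H ⧸ N, (((χ q.out)⁻¹ : kˣ) : k) • ρ q.out v = v := fun q => by
    rw [hv, smul_smul, ← Units.val_mul, inv_mul_cancel, Units.val_one, one_smul]
  simp only [hterm, Finset.sum_const, Finset.card_univ, Nat.cast_smul_eq_nsmul]

/-- The averaging sum of a vector fixed by the NORMAL subgroup `N ≤ ker χ` is a `(H, χ)`-eigenvector:
`ρ h (Σ_q χ(q̃)⁻¹ • ρ(q̃) w) = χ h • Σ_q χ(q̃)⁻¹ • ρ(q̃) w` (reindex the cosets by `q ↦ h · q`).  (Private step.)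
[folklore] -/
private theorem rho_sum_eq_smul (N : Subgroup H) [N.Normal] [Fintype (H ⧸ N)] (hNχ : N ≤ χ.ker) {w : S}
    (hNw : ∀ n ∈ N, ρ n w = w) (h : H) :
    ρ h (∑ q : H ⧸ N, (((χ q.out)⁻¹ : kˣ) : k) • ρ q.out w) =
      ((χ h : kˣ) : k) • ∑ q : H ⧸ N, (((χ q.out)⁻¹ : kˣ) : k) • ρ q.out w := by
  -- `φ z = χ(z)⁻¹ • ρ(z) w` is constant on the cosets `z N`
  set φ : H → S := fun z => (((χ z)⁻¹ : kˣ) : k) • ρ z w with hφ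
  have hφN : ∀ (z : H) (n : H), n ∈ N → φ (z * n) = φ z := by
    intro z n hn
    have hχn : χ n = 1 := hNχ hn
    simp only [hφ, map_mul, hχn, mul_one, Module.End.mul_apply, hNw n hn]
  have hφout : ∀ z : H, φ ((QuotientGroup.mk z : H ⧸ N).out) = φ z := by
    intro z
    obtain ⟨n, hn⟩ := QuotientGroup.mk_out_eq_mul N z
    rw [hn]
    exact hφN z n n.2
  rw [map_sum, Finset.smul_sum]
  -- `ρ h (φ z) = χ h • φ (h z)`
  have hL : ∀ q : H ⧸ N, ρ h ((((χ q.out)⁻¹ : kˣ) : k) • ρ q.out w) = ((χ h : kˣ) : k) • φ (h * q.out) := by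
    intro q
    show ρ h ((((χ q.out)⁻¹ : kˣ) : k) • ρ q.out w) =
      ((χ h : kˣ) : k) • ((((χ (h * q.out))⁻¹ : kˣ) : k) • ρ (h * q.out) w)
    rw [map_smul, map_mul, map_mul, Module.End.mul_apply, smul_smul, ← Units.val_mul, mul_inv_rev,
      ← mul_assoc, mul_comm (χ h) ((χ q.out)⁻¹), mul_inv_cancel_right]
  simp_rw [hL]
  -- reindex by `q ↦ (mk h) * q`
  have hre : ∀ q : H ⧸ N, φ (h * q.out) = φ (((QuotientGroup.mk h : H ⧸ N) * q).out) := by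
    intro q
    rw [← hφout (h * q.out), QuotientGroup.mk_mul, QuotientGroup.out_eq']
  simp_rw [hre]
  exact Fintype.sum_equiv (Equiv.mulLeft (QuotientGroup.mk h : H ⧸ N)) _ _ fun q => rfl

/-- The class of the averaging sum is `[H : N] • mk w`.  (Private step.) [folklore] -/
private theorem mk_sum_eq (N : Subgroup H) [Fintype (H ⧸ N)] (w : S) :
    mk ρ χ (∑ q : H ⧸ N, (((χ q.out)⁻¹ : kˣ) : k) • ρ q.out w) = (Fintype.card (H ⧸ N) : k) • mk ρ χ w := by
  rw [map_sum]
  have hterm : ∀ q : H ⧸ N, mk ρ χ ((((χ q.out)⁻¹ : kˣ) : k) • ρ q.out w) = mk ρ χ w := fun q => by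
    rw [map_smul, mk_ρW, smul_smul, ← Units.val_mul, inv_mul_cancel, Units.val_one, one_smul]
  simp only [hterm, Finset.sum_const, Finset.card_univ, Nat.cast_smul_eq_nsmul]

variable [CharZero k]

/-- **Every class in the `χ`-coinvariants is the class of a `(H, χ)`-eigenvector** (algebraic form): if every vector
is fixed by a normal finite-index subgroup of `H` inside `ker χ`, then for every `w` there is `v` in the isotypic
subspace with `mk v = mk w` — namely `v = [H:N]⁻¹ Σ_{q ∈ H/N} χ(q̃)⁻¹ ρ(q̃) w`. [cite: BernsteinZelevinsky1976, §2.3] -/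
theorem exists_mem_weightSpace_mk_eq_of_forall_exists_normal
    (hN : ∀ w : S, ∃ N : Subgroup H, N.Normal ∧ N.FiniteIndex ∧ N ≤ χ.ker ∧ ∀ n ∈ N, ρ n w = w) (w : S) :
    ∃ v ∈ weightSpace ρ id (fun h => ((χ h : kˣ) : k)), mk ρ χ v = mk ρ χ w := by
  obtain ⟨N, hNn, hNf, hNχ, hNw⟩ := hN w
  haveI := hNn
  haveI := hNf
  haveI : Fintype (H ⧸ N) := N.fintypeQuotientOfFiniteIndex
  have hc : (Fintype.card (H ⧸ N) : k) ≠ 0 := Nat.cast_ne_zero.2 Fintype.card_ne_zero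
  refine ⟨(Fintype.card (H ⧸ N) : k)⁻¹ • ∑ q : H ⧸ N, (((χ q.out)⁻¹ : kˣ) : k) • ρ q.out w, ?_, ?_⟩
  · rw [mem_weightSpace]
    intro h
    rw [id, map_smul, rho_sum_eq_smul ρ χ N hNχ hNw h, smul_comm]
  · rw [map_smul, mk_sum_eq, smul_smul, inv_mul_cancel₀ hc, one_smul]

/-- **`mk` is injective on the isotypic subspace** (algebraic form): two `(H, χ)`-eigenvectors with the same class
are equal (tree `mk_ne_zero_of_eigenvector_of_forall_exists_normal` applied to the difference).
[cite: BernsteinZelevinsky1976, §2.3] -/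
theorem eq_of_mk_eq_of_forall_exists_normal
    (hN : ∀ w : S, ∃ N : Subgroup H, N.Normal ∧ N.FiniteIndex ∧ N ≤ χ.ker ∧ ∀ n ∈ N, ρ n w = w) {v v' : S}
    (hv : v ∈ weightSpace ρ id (fun h => ((χ h : kˣ) : k)))
    (hv' : v' ∈ weightSpace ρ id (fun h => ((χ h : kˣ) : k))) (h : mk ρ χ v = mk ρ χ v') : v = v' := by
  by_contra hne
  have hsub : v - v' ∈ weightSpace ρ id (fun h => ((χ h : kˣ) : k)) := Submodule.sub_mem _ hv hv'
  rw [mem_weightSpace] at hsub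
  exact mk_ne_zero_of_eigenvector_of_forall_exists_normal ρ χ hN (sub_ne_zero.2 hne) hsub
    (by rw [map_sub, h, sub_self])

end Algebra

/-! ## §2. Topology: compact groups, smooth representations -/

section Compact

variable {k : Type*} [Field k] [CharZero k] {H : Type*} [Group H] [TopologicalSpace H] [IsTopologicalGroup H]
  [CompactSpace H] {S : Type*} [AddCommGroup S] [Module k S] (ρ : Representation k H S) (χ : H →* kˣ)

omit [CharZero k] in
/-- For `H` compact, `ρ` smooth and `ker χ` open, every vector is fixed by a normal open (hence finite-index)
subgroup inside `ker χ`: the normal core of `ker χ ∩ Stab(w)`. [cite: BernsteinZelevinsky1976, §2.1] -/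
theorem forall_exists_normal_of_isSmooth (hρ : ρ.IsSmooth) (hχ : IsOpen (χ.ker : Set H)) (w : S) :
    ∃ N : Subgroup H, N.Normal ∧ N.FiniteIndex ∧ N ≤ χ.ker ∧ ∀ n ∈ N, ρ n w = w := by
  set K : Subgroup H := χ.ker ⊓ ρ.stabilizerSubgroup w with hK
  have hKo : IsOpen (K : Set H) := hχ.inter (hρ w)
  haveI : Finite (H ⧸ K) := Subgroup.quotient_finite_of_isOpen K hKo
  haveI : K.FiniteIndex := Subgroup.finiteIndex_of_finite_quotient
  refine ⟨K.normalCore, inferInstance, inferInstance, (Subgroup.normalCore_le K).trans inf_le_left, fun n hn => ?_⟩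
  exact (ρ.mem_stabilizerSubgroup w n).1 (Subgroup.mem_inf.1 (Subgroup.normalCore_le K hn)).2

/-- **Every class in the `χ`-coinvariants of a compact group is the class of a `(H, χ)`-eigenvector** (`ρ` smooth,
`ker χ` open). [cite: BernsteinZelevinsky1976, §2.3] -/
theorem exists_mem_weightSpace_mk_eq (hρ : ρ.IsSmooth) (hχ : IsOpen (χ.ker : Set H)) (w : S) :
    ∃ v ∈ weightSpace ρ id (fun h => ((χ h : kˣ) : k)), mk ρ χ v = mk ρ χ w :=
  exists_mem_weightSpace_mk_eq_of_forall_exists_normal ρ χ (forall_exists_normal_of_isSmooth ρ χ hρ hχ) w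

/-- **`mk` is injective on the isotypic subspace of a compact group** (`ρ` smooth, `ker χ` open).
[cite: BernsteinZelevinsky1976, §2.3] -/
theorem eq_of_mk_eq (hρ : ρ.IsSmooth) (hχ : IsOpen (χ.ker : Set H)) {v v' : S}
    (hv : v ∈ weightSpace ρ id (fun h => ((χ h : kˣ) : k)))
    (hv' : v' ∈ weightSpace ρ id (fun h => ((χ h : kˣ) : k))) (h : mk ρ χ v = mk ρ χ v') : v = v' :=
  eq_of_mk_eq_of_forall_exists_normal ρ χ (forall_exists_normal_of_isSmooth ρ χ hρ hχ) hv hv' h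

/-- **The compact-group dictionary**: `mk` restricts to a linear BIJECTION from the `χ`-isotypic subspace
`{v | ρ h v = χ h • v}` onto the `χ`-coinvariants `Coinv ρ χ` (`H` compact, `ρ` smooth, `ker χ` open; isotypic
subspace = isotypic quotient for compact groups). [cite: BernsteinZelevinsky1976, §2.3] -/
theorem bijective_mk_domRestrict_weightSpace (hρ : ρ.IsSmooth) (hχ : IsOpen (χ.ker : Set H)) :
    Function.Bijective ((mk ρ χ).domRestrict (weightSpace ρ id (fun h => ((χ h : kˣ) : k)))) := by
  refine ⟨fun v v' hvv' => Subtype.ext (eq_of_mk_eq ρ χ hρ hχ v.2 v'.2 hvv'), fun x => ?_⟩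
  obtain ⟨w, rfl⟩ := mk_surjective ρ χ x
  obtain ⟨v, hv, hvw⟩ := exists_mem_weightSpace_mk_eq ρ χ hρ hχ w
  exact ⟨⟨v, hv⟩, hvw⟩

/-- The dictionary as a linear equivalence `weightSpace ρ id χ ≃ₗ[k] Coinv ρ χ` extending `mk` (existence; it is
`LinearEquiv.ofBijective` of `bijective_mk_domRestrict_weightSpace`).  With a commuting representation `ρV` of a
group `G` it intertwines `ρV` (which preserves the isotypic subspace, `map_weightSpace_le`) with `rep χ ρV hc`
(`rep_mk`). [cite: BernsteinZelevinsky1976, §2.3] -/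
theorem exists_linearEquiv_weightSpace_coinv (hρ : ρ.IsSmooth) (hχ : IsOpen (χ.ker : Set H)) :
    ∃ e : weightSpace ρ id (fun h => ((χ h : kˣ) : k)) ≃ₗ[k] Coinv ρ χ, ∀ v, e v = mk ρ χ v :=
  ⟨LinearEquiv.ofBijective _ (bijective_mk_domRestrict_weightSpace ρ χ hρ hχ), fun _ => rfl⟩

end Compact

/-! ## §3. Subrepresentations of the coinvariants = stable subspaces of the isotypic subspace -/

section Irreducible

open Literature.NumberTheory.Automorphic

variable {H : Type*} [Group H] [TopologicalSpace H] [IsTopologicalGroup H] [CompactSpace H]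
  {G S : Type} [Group G] [AddCommGroup S] [Module ℂ S] (ρ : Representation ℂ H S) (χ : H →* ℂˣ)
  (ρV : Representation ℂ G S) (hc : ∀ (g : G) (h : H), Commute (ρV g) (ρ h))

/-- **Irreducibility of the coinvariants read on the isotypic subspace** (`H` compact, `ρ` smooth, `ker χ` open,
`ρV` a commuting representation of `G`): the `G`-representation `rep χ ρV hc` on `Coinv ρ χ` is irreducible-or-zero
in the sense of [Liu2021, Def. 4.11] iff every `ρV`-stable subspace of the `χ`-isotypic subspace
`E = {v | ρ h v = χ h • v}` is `⊥` or `E` — the subrepresentations of the coinvariants correspond to the `ρV`-stable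
subspaces of `E` under the dictionary `bijective_mk_domRestrict_weightSpace`. [cite: BernsteinZelevinsky1976, §2.3] -/
theorem isIrreducibleOrZero_rep_iff (hρ : ρ.IsSmooth) (hχ : IsOpen (χ.ker : Set H)) :
    Liu2021.IsIrreducibleOrZero (rep χ ρV hc) ↔
      ∀ W : Submodule ℂ S, W ≤ weightSpace ρ id (fun h => ((χ h : ℂˣ) : ℂ)) →
        (∀ g : G, W.map (ρV g) ≤ W) → W = ⊥ ∨ W = weightSpace ρ id (fun h => ((χ h : ℂˣ) : ℂ)) := by
  set E : Submodule ℂ S := weightSpace ρ id (fun h => ((χ h : ℂˣ) : ℂ)) with hE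
  have hinj : ∀ {v v' : S}, v ∈ E → v' ∈ E → mk ρ χ v = mk ρ χ v' → v = v' :=
    fun hv hv' h => eq_of_mk_eq ρ χ hρ hχ hv hv' h
  have hsurj : ∀ w : S, ∃ v ∈ E, mk ρ χ v = mk ρ χ w := exists_mem_weightSpace_mk_eq ρ χ hρ hχ
  constructor
  · intro hirr W hWE hWst
    -- the image of `W` is a subrepresentation
    let W' : Subrepresentation (rep χ ρV hc) :=
      ⟨W.map (mk ρ χ), fun g => by
        rintro _ ⟨w, hw, rfl⟩
        exact ⟨ρV g w, hWst g ⟨w, hw, rfl⟩, (rep_mk χ ρV hc g w).symm⟩⟩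
    rcases hirr W' with h0 | h1
    · left
      rw [eq_bot_iff]
      intro w hw
      have hmk : mk ρ χ w ∈ W'.toSubmodule := ⟨w, hw, rfl⟩
      rw [h0] at hmk
      change mk ρ χ w ∈ (⊥ : Submodule ℂ (Coinv ρ χ)) at hmk
      rw [Submodule.mem_bot] at hmk
      rw [Submodule.mem_bot]
      exact hinj (hWE hw) (Submodule.zero_mem _) (by rw [hmk, map_zero])
    · right
      refine le_antisymm hWE fun v hv => ?_
      have hmk : mk ρ χ v ∈ W'.toSubmodule := by
        rw [h1]
        exact Submodule.mem_top
      obtain ⟨w, hw, hwv⟩ := hmk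
      rwa [← hinj (hWE hw) hv hwv]
  · intro hlat W'
    -- the eigenvectors whose class lies in `W'`
    let W : Submodule ℂ S := E ⊓ W'.toSubmodule.comap (mk ρ χ)
    have hWE : W ≤ E := inf_le_left
    have hWst : ∀ g : G, W.map (ρV g) ≤ W := fun g => by
      rintro _ ⟨w, ⟨hwE, hwW⟩, rfl⟩
      refine ⟨map_weightSpace_le ρ χ (ρV g) (hc g) ⟨w, hwE, rfl⟩, ?_⟩
      change mk ρ χ (ρV g w) ∈ W'.toSubmodule
      rw [← rep_mk χ ρV hc]
      exact W'.apply_mem_toSubmodule g hwW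
    rcases hlat W hWE hWst with h0 | h1
    · left
      apply Subrepresentation.toSubmodule_injective
      change W'.toSubmodule = ⊥
      rw [eq_bot_iff]
      intro x hx
      obtain ⟨w, rfl⟩ := mk_surjective ρ χ x
      obtain ⟨v, hvE, hvw⟩ := hsurj w
      have hvW : v ∈ W := ⟨hvE, by change mk ρ χ v ∈ W'.toSubmodule; rwa [hvw]⟩
      rw [h0, Submodule.mem_bot] at hvW
      rw [Submodule.mem_bot, ← hvw, hvW, map_zero]
    · right
      apply Subrepresentation.toSubmodule_injective
      change W'.toSubmodule = ⊤
      rw [eq_top_iff]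
      intro x _
      obtain ⟨w, rfl⟩ := mk_surjective ρ χ x
      obtain ⟨v, hvE, hvw⟩ := hsurj w
      have hvW : v ∈ W := by rw [h1]; exact hvE
      rw [← hvw]
      exact hvW.2

end Irreducible

end Literature.RepresentationTheory.TwistedCoinv

end
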